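import Mathlib.Algebra.MvPolynomial.PDeriv
import Mathlib.LinearAlgebra.Matrix.SchurComplement
import Mathlib.LinearAlgebra.Matrix.Determinant.Basic
import Summits.HodgeConjecture.HodgeConjecture.Theorems.PadicSemiregularLiftSemiregularSeedsOnAnchorsLinearCycleSupplyHelpers
import HarnessLib

/-!
# Linear cycles on the Fermat fourfold: the Jacobian of `(ℓ, q)` is block diagonal

Sequel of `…LinearCycleSupplyHelpers` (stub S4a `stub_linearCycleSupply`, line
`gorenstein-ci-seeds`, crux `PadicSemiregularLift.SemiregularSeedsOnAnchors`). For three disjoint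
pairs `{u_t, v_t} = {σ(2t), σ(2t+1)}` of the six variables, with linear forms
`ℓ_t = x_{u_t} − ζ x_{v_t}` and cofactors `q_t = Σ_{i<m} x_{u_t}^i (ζ x_{v_t})^{m−1−i}`, the
`6 × 6` Jacobian matrix `(∂_j H_i)` of `H = (ℓ_0, ℓ_1, ℓ_2, q_0, q_1, q_2)` becomes, after
reordering rows as `(ℓ | q)` and columns as `(u | v)`, the block matrix
`[[1, −ζ·1], [diag ∂_u q, diag ∂_v q]]`, so `det (∂_j H_i) = ± ∏_t (∂_{v_t} q_t + ζ ∂_{u_t} q_t)`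
(`det_jac_eq_or`), and the coefficient of any monomial `x^e` with `e(u_t) + e(v_t) = m − 2` on
each pair is `± m³ ζ^{…} ≠ 0` (`coeff_det_jac_ne_zero`): VISIBILITY of the linear cycle at every
three-pair character. Also: `(ℓ_0, ℓ_1, ℓ_2)` is a prime ideal (`isPrime_span_range_linF`).

Conventions: the standard pairs are `(0,1), (2,3), (4,5)` (first members `![0, 2, 4]`, second
members `![1, 3, 5]`), moved by `σ`; the families `ℓ = (ℓ_t)`, `q = (q_t)` enter the statements as
variables `f g : Fin 3 → R[x_0, …, x_5]` pinned by equations `hf`, `hg`; `(∂_j H_i)` is the Jacobian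
of `H = (f, g)` with rows indexed through `finSumFinEquiv : Fin 3 ⊕ Fin 3 ≃ Fin 6`, as in
`CIDatum.H` of the line. Everything here is proved; no named facts; no definitions.
-/

set_option linter.dupNamespace false

universe u

namespace Summit.HodgeConjecture.HodgeConjecture.Theorems.SemiregularSeedsOnAnchors.GorensteinCiSeeds

namespace LinearCycle

open MvPolynomial Matrix

variable {R : Type*} [CommRing R]

/-- `det (∂_j H_i) = ± ∏_t (∂_{v_t} q_t + ζ ∂_{u_t} q_t)`: after reordering rows as `(ℓ | q)` and
columns as `(u | v)` the Jacobian is the block matrix `[[1, −ζ], [diag ∂_u q, diag ∂_v q]]`.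
[folklore] -/
theorem det_jac_eq_or (σ : Equiv.Perm (Fin 6)) (ζ : R) (m : ℕ)
    {f g : Fin 3 → MvPolynomial (Fin 6) R}
    (hf : f = fun t => X (σ (![0, 2, 4] t)) - C ζ * X (σ (![1, 3, 5] t)))
    (hg : g = fun t => ∑ i ∈ Finset.range m,
      X (σ (![0, 2, 4] t)) ^ i * (C ζ * X (σ (![1, 3, 5] t))) ^ (m - 1 - i)) :
    (Matrix.of fun i j : Fin 6 => pderiv j (Sum.elim f g ((@finSumFinEquiv 3 3).symm i))).det =
        ∏ t, (pderiv (σ (![1, 3, 5] t)) (g t) + C ζ * pderiv (σ (![0, 2, 4] t)) (g t)) ∨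
      (Matrix.of fun i j : Fin 6 => pderiv j (Sum.elim f g ((@finSumFinEquiv 3 3).symm i))).det =
        -∏ t, (pderiv (σ (![1, 3, 5] t)) (g t) + C ζ * pderiv (σ (![0, 2, 4] t)) (g t)) := by
  set J : Matrix (Fin 6) (Fin 6) (MvPolynomial (Fin 6) R) :=
    Matrix.of fun i j : Fin 6 => pderiv j (Sum.elim f g ((@finSumFinEquiv 3 3).symm i)) with hJ
  -- block form after reindexing rows by `(ℓ | q)` and columns by `(u | v)`
  have hblock : J.submatrix (@finSumFinEquiv 3 3) (fun y => σ (Sum.elim ![0, 2, 4] ![1, 3, 5] y)) =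
      Matrix.fromBlocks 1 (Matrix.diagonal fun _ => -C ζ)
        (Matrix.diagonal fun t => pderiv (σ (![0, 2, 4] t)) (g t))
        (Matrix.diagonal fun t => pderiv (σ (![1, 3, 5] t)) (g t)) := by
    subst hf hg
    ext x y
    rcases x with t | t <;> rcases y with t' | t' <;> fin_cases t <;> fin_cases t' <;>
      simp only [J, Matrix.submatrix_apply, Matrix.of_apply, Equiv.symm_apply_apply, Sum.elim_inl,
        Sum.elim_inr, Matrix.fromBlocks_apply₁₁, Matrix.fromBlocks_apply₁₂,
        Matrix.fromBlocks_apply₂₁, Matrix.fromBlocks_apply₂₂, Matrix.diagonal_apply,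
        Matrix.one_apply] <;>
      simp [↓pderiv_linForm, ↓pderiv_geomForm_of_ne]
  -- the column reindexing is a permutation `τ` of the row reindexing
  have hinjI : Function.Injective (Sum.elim ![0, 2, 4] ![1, 3, 5] : Fin 3 ⊕ Fin 3 → Fin 6) := by
    decide
  have hbij : Function.Bijective fun y : Fin 3 ⊕ Fin 3 =>
      (@finSumFinEquiv 3 3).symm (σ (Sum.elim ![0, 2, 4] ![1, 3, 5] y)) :=
    (Fintype.bijective_iff_injective_and_card _).mpr
      ⟨(Equiv.injective _).comp (σ.injective.comp hinjI), by simp⟩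
  set τ : Equiv.Perm (Fin 3 ⊕ Fin 3) := Equiv.ofBijective _ hbij with hτ
  have h1 : J.submatrix (@finSumFinEquiv 3 3) (fun y => σ (Sum.elim ![0, 2, 4] ![1, 3, 5] y)) =
      (J.submatrix (@finSumFinEquiv 3 3) (@finSumFinEquiv 3 3)).submatrix id τ := by
    ext x y
    simp [τ]
  have h2 :
      (J.submatrix (@finSumFinEquiv 3 3) (fun y => σ (Sum.elim ![0, 2, 4] ![1, 3, 5] y))).det =
        Equiv.Perm.sign τ * J.det := by
    rw [h1, det_permute', det_submatrix_equiv_self]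
  have h3 :
      (J.submatrix (@finSumFinEquiv 3 3) (fun y => σ (Sum.elim ![0, 2, 4] ![1, 3, 5] y))).det =
        ∏ t, (pderiv (σ (![1, 3, 5] t)) (g t) + C ζ * pderiv (σ (![0, 2, 4] t)) (g t)) := by
    rw [hblock, det_fromBlocks_one₁₁, diagonal_mul_diagonal, diagonal_sub, det_diagonal]
    refine Finset.prod_congr rfl fun t _ => ?_
    ring
  rcases Int.units_eq_one_or (Equiv.Perm.sign τ) with hs | hs
  · left
    rw [hs] at h2
    simpa using h2.symm.trans h3
  · right
    rw [hs] at h2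
    have : -J.det =
        ∏ t, (pderiv (σ (![1, 3, 5] t)) (g t) + C ζ * pderiv (σ (![0, 2, 4] t)) (g t)) := by
      simpa using h2.symm.trans h3
    rw [← this, neg_neg]

/-- VISIBILITY of the linear cycle: for `ζ ≠ 0`, `m ≠ 0` in a domain `R` and an exponent `e` with
`e(σ(2t)) + e(σ(2t+1)) = m − 2` on each pair, the coefficient of `x^e` in `det (∂_j H_i)` is
non-zero (`= ± m³ ζ^{…}`). [folklore] -/
theorem coeff_det_jac_ne_zero [IsDomain R] (σ : Equiv.Perm (Fin 6)) {ζ : R} (hζ : ζ ≠ 0)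
    {m : ℕ} (hm : 2 ≤ m) (hmR : (m : R) ≠ 0) {f g : Fin 3 → MvPolynomial (Fin 6) R}
    (hf : f = fun t => X (σ (![0, 2, 4] t)) - C ζ * X (σ (![1, 3, 5] t)))
    (hg : g = fun t => ∑ i ∈ Finset.range m,
      X (σ (![0, 2, 4] t)) ^ i * (C ζ * X (σ (![1, 3, 5] t))) ^ (m - 1 - i))
    (e : Fin 6 →₀ ℕ) (he : ∀ t : Fin 3, e (σ (![0, 2, 4] t)) + e (σ (![1, 3, 5] t)) = m - 2) :
    coeff e (Matrix.of fun i j : Fin 6 =>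
      pderiv j (Sum.elim f g ((@finSumFinEquiv 3 3).symm i))).det ≠ 0 := by
  classical
  set u : Fin 3 → Fin 6 := fun t => σ (![0, 2, 4] t) with hu
  set v : Fin 3 → Fin 6 := fun t => σ (![1, 3, 5] t) with hv
  set D : Fin 3 → MvPolynomial (Fin 6) R := fun t => pderiv (v t) (g t) + C ζ * pderiv (u t) (g t)
    with hDdef
  -- reduce to the product of the three block determinants
  suffices h : coeff e (∏ t, D t) ≠ 0 by
    rcases det_jac_eq_or σ ζ m hf hg with h' | h' <;> rw [h'] <;> simpa using h
  have hD : ∀ t, D t ∈ supported R ({u t, v t} : Set (Fin 6)) :=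
    fun t => pairDet_mem_supported _ _ ζ m (by rw [hg])
  -- distinctness of the six indices, pulled back along `σ`
  have hinj : ∀ i j : Fin 6, σ i = σ j ↔ i = j := fun i j => σ.injective.eq_iff
  let S01 : Finset (Fin 6) := {u 0, v 0, u 1, v 1}
  let S0 : Finset (Fin 6) := {u 0, v 0}
  have h01 : D 0 * D 1 ∈ supported R (↑S01 : Set (Fin 6)) := by
    refine Subalgebra.mul_mem _ (supported_mono ?_ (hD 0)) (supported_mono ?_ (hD 1)) <;>
      intro w hw <;> simp only [Set.mem_insert_iff, Set.mem_singleton_iff] at hw <;>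
      rcases hw with rfl | rfl <;> simp [S01]
  have h2 : D 2 ∈ supported R ((↑S01 : Set (Fin 6))ᶜ) := by
    refine supported_mono ?_ (hD 2)
    intro w hw
    simp only [Set.mem_insert_iff, Set.mem_singleton_iff] at hw
    rcases hw with rfl | rfl <;> simp [S01, u, v, hinj]
  have h0 : D 0 ∈ supported R (↑S0 : Set (Fin 6)) := by
    refine supported_mono ?_ (hD 0)
    intro w hw
    simp only [Set.mem_insert_iff, Set.mem_singleton_iff] at hw
    rcases hw with rfl | rfl <;> simp [S0]
  have h1 : D 1 ∈ supported R ((↑S0 : Set (Fin 6))ᶜ) := by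
    refine supported_mono ?_ (hD 1)
    intro w hw
    simp only [Set.mem_insert_iff, Set.mem_singleton_iff] at hw
    rcases hw with rfl | rfl <;> simp [S0, u, v, hinj]
  rw [Fin.prod_univ_three, coeff_mul_of_mem_supported S01 h01 h2,
    coeff_mul_of_mem_supported S0 h0 h1]
  have huv : ∀ t, u t ≠ v t := by
    intro t; fin_cases t <;> simp [u, v, hinj]
  have cne : ∀ (t : Fin 3) (d : Fin 6 →₀ ℕ), d (u t) = e (u t) → d (v t) = e (v t) →
      (∀ w, w ≠ u t → w ≠ v t → d w = 0) → coeff d (D t) ≠ 0 := by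
    intro t d hdu hdv hd'
    rw [hDdef, coeff_pairDet (huv t) ζ hm (by rw [hg]) d (by rw [hdu, hdv]; exact he t) hd']
    exact mul_ne_zero hmR (pow_ne_zero _ hζ)
  -- membership facts
  have mem_S01 : ∀ w, w ∈ S01 ↔ w = u 0 ∨ w = v 0 ∨ w = u 1 ∨ w = v 1 := by
    intro w; simp [S01]
  have mem_S0 : ∀ w, w ∈ S0 ↔ w = u 0 ∨ w = v 0 := by
    intro w; simp [S0]
  have hall : ∀ w, w = u 0 ∨ w = v 0 ∨ w = u 1 ∨ w = v 1 ∨ w = u 2 ∨ w = v 2 := by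
    intro w
    obtain ⟨j, rfl⟩ := σ.surjective w
    fin_cases j <;> simp [u, v, hinj]
  have hdist : u 0 ≠ u 1 ∧ u 0 ≠ v 1 ∧ u 0 ≠ u 2 ∧ u 0 ≠ v 2 ∧ v 0 ≠ u 1 ∧ v 0 ≠ v 1 ∧
      v 0 ≠ u 2 ∧ v 0 ≠ v 2 ∧ u 1 ≠ u 2 ∧ u 1 ≠ v 2 ∧ v 1 ≠ u 2 ∧ v 1 ≠ v 2 := by
    simp [u, v, hinj]
  obtain ⟨d01, d02, d03, d04, d05, d06, d07, d08, d09, d10, d11, d12⟩ := hdist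
  refine mul_ne_zero (mul_ne_zero (cne 0 _ ?_ ?_ ?_) (cne 1 _ ?_ ?_ ?_)) (cne 2 _ ?_ ?_ ?_)
  · simp [mem_S01, mem_S0]
  · simp [mem_S01, mem_S0]
  · intro w hwu hwv
    simp [mem_S0, hwu, hwv]
  · simp [mem_S01, mem_S0, Ne.symm d01, Ne.symm d05]
  · simp [mem_S01, mem_S0, Ne.symm d02, Ne.symm d06]
  · intro w hwu hwv
    simp only [Finsupp.filter_apply, mem_S01, mem_S0]
    split_ifs with hA hB <;> first | rfl | (exfalso; tauto)
  · simp [mem_S01, Ne.symm d03, Ne.symm d07, Ne.symm d09, Ne.symm d11]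
  · simp [mem_S01, Ne.symm d04, Ne.symm d08, Ne.symm d10, Ne.symm d12]
  · intro w hwu hwv
    simp only [Finsupp.filter_apply, mem_S01]
    split_ifs with hA <;>
      first | rfl | (exfalso; rcases hall w with h | h | h | h | h | h <;> tauto)

/-! ## The three pairs: non-vanishing and primality -/

/-- `ℓ_t q_t = x_{σ(2t)}^m + x_{σ(2t+1)}^m ≠ 0` (so `ℓ_t ≠ 0` and `q_t ≠ 0`). [folklore] -/
theorem linF_mul_geomG_ne_zero [Nontrivial R] (σ : Equiv.Perm (Fin 6)) {ζ : R} {m : ℕ}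
    (hζ : ζ ^ m = -1) (hm : m ≠ 0) (t : Fin 3) :
    (X (σ (![0, 2, 4] t)) - C ζ * X (σ (![1, 3, 5] t))) *
        (∑ i ∈ Finset.range m,
          X (σ (![0, 2, 4] t)) ^ i * (C ζ * X (σ (![1, 3, 5] t))) ^ (m - 1 - i)) ≠
      (0 : MvPolynomial (Fin 6) R) := by
  have hne : (![0, 2, 4] : Fin 3 → Fin 6) t ≠ (![1, 3, 5] : Fin 3 → Fin 6) t := by
    fin_cases t <;> decide
  rw [linForm_mul_geomForm _ _ hζ]
  exact X_pow_add_X_pow_ne_zero (fun h => hne (σ.injective h)) hm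

/-- The ideal `(ℓ_0, ℓ_1, ℓ_2)` of the three linear forms `x_{σ(2t)} − ζ x_{σ(2t+1)}` is prime: it
is the kernel of the substitution `x_{σ(2t)} ↦ ζ x_{σ(2t+1)}` into the domain `R[x]`. [folklore] -/
theorem isPrime_span_range_linF [IsDomain R] (σ : Equiv.Perm (Fin 6)) (ζ : R)
    {f : Fin 3 → MvPolynomial (Fin 6) R}
    (hf : f = fun t => X (σ (![0, 2, 4] t)) - C ζ * X (σ (![1, 3, 5] t))) :
    (Ideal.span (Set.range f)).IsPrime := by
  subst hf
  let tbl : Fin 6 → MvPolynomial (Fin 6) R :=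
    ![C ζ * X (σ 1), X (σ 1), C ζ * X (σ 3), X (σ 3), C ζ * X (σ 5), X (σ 5)]
  let φ : MvPolynomial (Fin 6) R →ₐ[R] MvPolynomial (Fin 6) R := aeval fun i => tbl (σ.symm i)
  set I := Ideal.span (Set.range fun t : Fin 3 =>
    (X (σ (![0, 2, 4] t)) - C ζ * X (σ (![1, 3, 5] t)) : MvPolynomial (Fin 6) R)) with hI
  have hφX : ∀ j : Fin 6, φ (X (σ j)) = tbl j := by
    intro j
    simp [φ]
  have hmem : ∀ t : Fin 3,
      (X (σ (![0, 2, 4] t)) - C ζ * X (σ (![1, 3, 5] t)) : MvPolynomial (Fin 6) R) ∈ I :=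
    fun t => Ideal.subset_span ⟨t, rfl⟩
  have hker : ∀ t : Fin 3,
      φ (X (σ (![0, 2, 4] t)) - C ζ * X (σ (![1, 3, 5] t)) : MvPolynomial (Fin 6) R) = 0 := by
    intro t
    fin_cases t <;> simp [hφX, tbl]
  have hX : ∀ n, X n - φ (X n) ∈ I := by
    intro n
    obtain ⟨j, rfl⟩ := σ.surjective n
    rw [hφX]
    fin_cases j
    · exact hmem 0
    · simp [tbl]
    · exact hmem 1
    · simp [tbl]
    · exact hmem 2
    · simp [tbl]
  have hcong : ∀ P : MvPolynomial (Fin 6) R, P - φ P ∈ I := by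
    intro P
    induction P using MvPolynomial.induction_on with
    | C a => simp [φ]
    | add p q hp hq =>
      have := I.add_mem hp hq
      convert this using 1
      rw [map_add]
      ring
    | mul_X p n hp =>
      have := I.add_mem (I.mul_mem_right (X n) hp) (I.mul_mem_left (φ p) (hX n))
      convert this using 1
      rw [map_mul]
      ring
  have hIker : I = RingHom.ker φ := by
    apply le_antisymm
    · rw [hI, Ideal.span_le]
      rintro _ ⟨t, rfl⟩
      exact hker t
    · intro P hP
      rw [RingHom.mem_ker] at hP
      have := hcong P
      rwa [hP, sub_zero] at this
  rw [hIker]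
  exact RingHom.ker_isPrime φ

/-! ## Registered sub-goal (closed form) -/

/-- Registered sub-goal of stub `stub_linearCycleSupply` (= `coeff_det_jac_ne_zero` with
explicit binders and the families written in place): VISIBILITY of the linear cycle
`x_{σ(2t)} = ζ x_{σ(2t+1)}` — the coefficient of `x^e` in the transition determinant
`det (∂_j H_i)`, `H = (ℓ_0, ℓ_1, ℓ_2, q_0, q_1, q_2)`, is non-zero whenever `e` has pair sums `m − 2`. [folklore] -/
theorem coeff_det_jacobian_linearCycle_ne_zero :
    ∀ (R : Type u) [CommRing R] [IsDomain R] (σ : Equiv.Perm (Fin 6)) (ζ : R) (_ : ζ ≠ 0) (m : ℕ)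
      (_ : 2 ≤ m) (_ : (m : R) ≠ 0) (e : Fin 6 →₀ ℕ)
      (_ : ∀ t : Fin 3, e (σ ((![0, 2, 4] : Fin 3 → Fin 6) t)) +
        e (σ ((![1, 3, 5] : Fin 3 → Fin 6) t)) = m - 2),
      MvPolynomial.coeff e (Matrix.det (Matrix.of fun i j : Fin 6 => MvPolynomial.pderiv j
        (Sum.elim
          (fun t : Fin 3 => (MvPolynomial.X (σ ((![0, 2, 4] : Fin 3 → Fin 6) t)) -
            MvPolynomial.C ζ * MvPolynomial.X (σ ((![1, 3, 5] : Fin 3 → Fin 6) t)) :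
              MvPolynomial (Fin 6) R))
          (fun t : Fin 3 => ∑ i ∈ Finset.range m,
            MvPolynomial.X (σ ((![0, 2, 4] : Fin 3 → Fin 6) t)) ^ i *
              (MvPolynomial.C ζ * MvPolynomial.X (σ ((![1, 3, 5] : Fin 3 → Fin 6) t))) ^
                (m - 1 - i))
          ((@finSumFinEquiv 3 3).symm i)))) ≠ 0 := by
  intro R _ _ σ ζ hζ m hm hmR e he
  exact coeff_det_jac_ne_zero σ hζ hm hmR rfl rfl e he

end LinearCycle

end Summit.HodgeConjecture.HodgeConjecture.Theorems.SemiregularSeedsOnAnchors.GorensteinCiSeeds
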